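import Mathlib
import Summits.ValiantsHypothesis.ValiantsHypothesis.Theorems.LacunarySymmetroidMatrixDescartesCensusDefs
import Summits.ValiantsHypothesis.ValiantsHypothesis.Theorems.LacunarySymmetroidMatrixDescartesGraftToolkit

/-!
# Tower graft line — EXACT PIVOT NORMALISATION BY CONGRUENCE («WLOG every principal pivot pencil is non-degenerate»)

Mechanism piece for LINE (B) `Cruxes/WeakLifting/Lines/tower_graft.lean` (rev 9; crux `WeakLifting` = stmt-ValiantsHypothesis-19561,
restricted sub-case `TowerWeakLifting`), S4f / T5 side (desk R2744 (C) GO; planner val-idea-24 g0, critic crit-6 g0; complement of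
val-sym-lift-p2 g18's `…TowerGraftSylvesterCompression`).  NO registered stub is closed by this file (S4f/T5 stay research).

The Sylvester compression of a size-`(2s−1)` symmetric pencil `G = ∑ X^{dₗ} Sₗ` to the `s × s` symmetric MINOR PENCIL needs a pivot
block with `det G_M ≢ 0`, and HOLLOW pencils (every principal `(s−1)`-minor `≡ 0` while `det G ≢ 0`, e.g. `[[0,a,b],[a,0,c],[b,c,0]]`)
show that this is a genuine restriction on the letters.  It is removed LOSSLESSLY by a constant congruence:

* §1 `transpose_mul_pencil_mul`, `roots_det_pencil_congr` — congruence by a constant matrix `V` acts letterwise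
  (`V̂ᵀ (∑ X^{dₗ} Sₗ) V̂ = ∑ X^{dₗ} (Vᵀ Sₗ V)`) and, for `det V ≠ 0`, keeps the root multiset of the determinant.
* §2 `pencil_map_eval`, `eval_det_pencil` — evaluation of a pencil / of its determinant at a real point.
* §3 `exists_congruent_nondegenerate_pivots` — for symmetric letters with `det G ≢ 0`: take a non-root `t₀` of `det G` and the
  orthogonal eigenframe `U` of the real symmetric matrix `G(t₀)` (tree: `Census.Graft.exists_orth_frame`); the congruent letters
  `Uᵀ Sₗ U` are symmetric, live on the SAME support, have the SAME determinant roots, and EVERY principal sub-pencil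
  `∑ X^{dₗ} (Uᵀ Sₗ U)[f,f]` (`f` injective) has non-vanishing determinant — at `t₀` it is a diagonal matrix of non-zero eigenvalues.
* §4 `posRootLawOn_of_nondegenerate_pivots`, `card_roots_le_of_nondegenerate_pivots` — hence a support-level budget
  `PosRootLawOn N K B d` (and its all-real-roots twin) may be proved on letter tuples all of whose principal pivot pencils are
  non-degenerate.  With lift-p2's compression `Z₊(det G) ≤ Z₊(det 𝔅_s)` (non-degenerate pivot) this makes «T5 (typed for
  non-degenerate pivots) ⇒ S4f» a joint for ALL letter tuples, with no factor and no density argument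
  (`…PosRootLawDenseTransfer` is the tree's alternative for conditions that are dense but not congruence-reachable).

Def-free; Mathlib + two route-independent tree files.  HONEST FRAMING: spectral-theorem bookkeeping; it proves no stub of the line
and nothing about `WeakLifting`, Conjecture B / `KPlusLogSqLaw`, `MatrixDescartes` (18050) or `VP ≠ VNP`.
Seat: prover val-sym-lift-p3 g17, `--supports stmt-ValiantsHypothesis-19561`.
-/

-- `Summit.ValiantsHypothesis.ValiantsHypothesis.…` repeats a component by the D-0017 layout
-- (single-conjunct summit), which the `dupNamespace` linter flags; the name is mandated.
set_option linter.dupNamespace false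

namespace Summit.ValiantsHypothesis.ValiantsHypothesis.Theorems.KPlusLogSqLaw.TowerGraft

open Finset Polynomial Matrix
open scoped BigOperators Polynomial
open Summit.ValiantsHypothesis.ValiantsHypothesis.Theorems.LacunarySymmetroidMatrixDescartes (PosRootLawOn)

/-! ### §1 Congruence by a constant matrix acts letterwise on a lacunary pencil and keeps the root multiset -/

/-- congruence acts letterwise: `V̂ᵀ (∑ X^{dₗ} • Sₗ) V̂ = ∑ X^{dₗ} • (Vᵀ Sₗ V)`, `V̂ = V.map C`. [folklore] -/
theorem transpose_mul_pencil_mul {n : Type*} [Fintype n] [DecidableEq n] {K : ℕ} (V : Matrix n n ℝ) (d : Fin K → ℕ)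
    (S : Fin K → Matrix n n ℝ) :
    (V.map Polynomial.C)ᵀ * (∑ l, ((X : ℝ[X]) ^ d l) • (S l).map Polynomial.C) * V.map Polynomial.C =
      ∑ l, ((X : ℝ[X]) ^ d l) • (Vᵀ * S l * V).map Polynomial.C := by
  simp only [Finset.mul_sum, Finset.sum_mul, Matrix.mul_smul, Matrix.smul_mul, Matrix.map_mul, Matrix.transpose_map]

/-- congruence by an invertible constant matrix keeps the root multiset of the pencil determinant. [folklore] -/
theorem roots_det_pencil_congr {n : Type*} [Fintype n] [DecidableEq n] {K : ℕ} (V : Matrix n n ℝ) (hV : V.det ≠ 0)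
    (d : Fin K → ℕ) (S : Fin K → Matrix n n ℝ) :
    (∑ l, ((X : ℝ[X]) ^ d l) • (Vᵀ * S l * V).map Polynomial.C).det.roots =
      (∑ l, ((X : ℝ[X]) ^ d l) • (S l).map Polynomial.C).det.roots := by
  rw [← transpose_mul_pencil_mul, Matrix.det_mul, Matrix.det_mul, Matrix.det_transpose]
  have hdet : (V.map Polynomial.C).det = Polynomial.C V.det := by
    rw [RingHom.map_det, RingHom.mapMatrix_apply]
  rw [hdet, mul_comm (Polynomial.C V.det) _, mul_assoc, ← Polynomial.C_mul, mul_comm, Polynomial.roots_C_mul _ (mul_ne_zero hV hV)]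

/-! ### §2 Evaluation of pencils -/

/-- evaluating the pencil at a real point: `(∑ X^{dₗ} • Sₗ)(t) = ∑ t^{dₗ} • Sₗ`. [folklore] -/
theorem pencil_map_eval {n : Type*} [Fintype n] [DecidableEq n] {K : ℕ} (t : ℝ) (d : Fin K → ℕ)
    (S : Fin K → Matrix n n ℝ) :
    (∑ l, ((X : ℝ[X]) ^ d l) • (S l).map Polynomial.C).map (Polynomial.eval t) = ∑ l, (t ^ d l) • S l := by
  ext i j
  simp only [Matrix.map_apply, Matrix.sum_apply, Matrix.smul_apply, smul_eq_mul, Polynomial.eval_finsetSum,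
    Polynomial.eval_mul, Polynomial.eval_pow, Polynomial.eval_X, Polynomial.eval_C]

/-- the determinant of the pencil evaluated at `t` is the determinant of the evaluated pencil. [folklore] -/
theorem eval_det_pencil {n : Type*} [Fintype n] [DecidableEq n] {K : ℕ} (t : ℝ) (d : Fin K → ℕ)
    (S : Fin K → Matrix n n ℝ) :
    Polynomial.eval t (∑ l, ((X : ℝ[X]) ^ d l) • (S l).map Polynomial.C).det = (∑ l, (t ^ d l) • S l).det := by
  rw [← Polynomial.coe_evalRingHom, RingHom.map_det, RingHom.mapMatrix_apply, Polynomial.coe_evalRingHom, pencil_map_eval]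

/-! ### §3 The normalisation: congruent letters all of whose principal pivot pencils are non-degenerate -/

/-- **EXACT PIVOT NORMALISATION BY CONGRUENCE.**  For symmetric letters `S` on the support `d` with `det (∑ X^{dₗ} Sₗ) ≢ 0` there
are CONGRUENT symmetric letters `S'ₗ = Uᵀ Sₗ U` (`U` a constant orthogonal matrix: the spectral frame of the pencil at one
non-root `t₀`) on the SAME support with the SAME root multiset of the determinant, such that EVERY principal sub-pencil
`∑ X^{dₗ} S'ₗ[f, f]` (`f` injective) has non-vanishing determinant (at `t₀` it is a diagonal matrix of non-zero eigenvalues).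
[this work] -/
theorem exists_congruent_nondegenerate_pivots {n : Type*} [Fintype n] [DecidableEq n] {K : ℕ} (d : Fin K → ℕ)
    (S : Fin K → Matrix n n ℝ) (hS : ∀ l, (S l).IsSymm)
    (hG : (∑ l, ((X : ℝ[X]) ^ d l) • (S l).map Polynomial.C).det ≠ 0) :
    ∃ S' : Fin K → Matrix n n ℝ, (∀ l, (S' l).IsSymm) ∧
      (∑ l, ((X : ℝ[X]) ^ d l) • (S' l).map Polynomial.C).det.roots =
        (∑ l, ((X : ℝ[X]) ^ d l) • (S l).map Polynomial.C).det.roots ∧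
      ∀ (ι : Type) [Fintype ι] [DecidableEq ι] (f : ι → n), Function.Injective f →
        (∑ l, ((X : ℝ[X]) ^ d l) • ((S' l).submatrix f f).map Polynomial.C).det ≠ 0 := by
  classical
  -- a non-root t₀ of det G
  obtain ⟨t₀, ht₀⟩ : ∃ t₀ : ℝ, Polynomial.eval t₀ (∑ l, ((X : ℝ[X]) ^ d l) • (S l).map Polynomial.C).det ≠ 0 := by
    by_contra h
    exact hG (Polynomial.zero_of_eval_zero _ fun x => not_not.mp (not_exists.mp h x))
  rw [eval_det_pencil] at ht₀
  -- the evaluated pencil is symmetric; diagonalise it orthogonally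
  have hA : (∑ l, (t₀ ^ d l) • S l).IsSymm := by
    show (∑ l, (t₀ ^ d l) • S l)ᵀ = ∑ l, (t₀ ^ d l) • S l
    rw [Matrix.transpose_sum]
    exact Finset.sum_congr rfl fun l _ => by rw [Matrix.transpose_smul, (hS l).eq]
  obtain ⟨U, ev, hUUt, hUtU, hdiag⟩ :=
    Summit.ValiantsHypothesis.ValiantsHypothesis.Theorems.LacunarySymmetroidMatrixDescartes.Census.Graft.exists_orth_frame _ hA
  have hdet : (∑ l, (t₀ ^ d l) • S l).det = ∏ i, ev i := by
    rw [← Summit.ValiantsHypothesis.ValiantsHypothesis.Theorems.LacunarySymmetroidMatrixDescartes.Census.Graft.det_transpose_mul_mul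
      U hUUt, hdiag, Matrix.det_diagonal]
  have hev : ∀ i, ev i ≠ 0 := by
    intro i hi
    apply ht₀
    rw [hdet]
    exact Finset.prod_eq_zero (Finset.mem_univ i) hi
  have hUdet : U.det ≠ 0 := by
    intro h0
    have h1 := congrArg Matrix.det hUtU
    rw [Matrix.det_mul, Matrix.det_transpose, h0, mul_zero, Matrix.det_one] at h1
    exact zero_ne_one h1
  refine ⟨fun l => Uᵀ * S l * U,
    fun l => Summit.ValiantsHypothesis.ValiantsHypothesis.Theorems.LacunarySymmetroidMatrixDescartes.Census.Graft.isSymm_transpose_mul_mul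
      U (hS l), roots_det_pencil_congr U hUdet d S, ?_⟩
  intro ι _ _ f hf hzero
  -- evaluate the principal sub-pencil of the congruent letters at t₀: a diagonal matrix of non-zero eigenvalues
  have h1 := congrArg (Polynomial.eval t₀) hzero
  rw [eval_det_pencil, Polynomial.eval_zero] at h1
  have h3 : Uᵀ * (∑ l, (t₀ ^ d l) • S l) * U = ∑ l, (t₀ ^ d l) • (Uᵀ * S l * U) :=
    Summit.ValiantsHypothesis.ValiantsHypothesis.Theorems.LacunarySymmetroidMatrixDescartes.Census.Graft.transpose_mul_sum_smul_mul U _ S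
  have h4 : (∑ l, (t₀ ^ d l) • (Uᵀ * S l * U).submatrix f f) = (∑ l, (t₀ ^ d l) • (Uᵀ * S l * U)).submatrix f f := by
    ext i j
    simp [Matrix.sum_apply]
  have h2 : (∑ l, (t₀ ^ d l) • (Uᵀ * S l * U).submatrix f f) = Matrix.diagonal (ev ∘ f) := by
    rw [h4, ← h3, hdiag, Matrix.submatrix_diagonal _ _ hf]
  rw [h2, Matrix.det_diagonal] at h1
  exact Finset.prod_ne_zero_iff.mpr (fun i _ => hev (f i)) h1

/-! ### §4 Consequence in census currency: support-level budgets may assume non-degenerate pivots -/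

/-- **WLOG every principal pivot pencil is non-degenerate.**  To prove a support-level positive-root budget `PosRootLawOn N K B d`
it suffices to bound the count for symmetric letter tuples ALL of whose principal sub-pencils have non-vanishing determinant
(the zero determinant has no roots; otherwise pass to the congruent normalised letters, which have the same roots).  This is the
lossless «generic letters suffice» step for the Sylvester / size-doubling route (T5 ⇒ S4f): Sylvester compression needs a pivot
block with `det ≢ 0`, and hollow pencils (all principal `(s−1)`-minors `≡ 0`, `det ≢ 0`) show that some normalisation is necessary.
[this work] -/
theorem posRootLawOn_of_nondegenerate_pivots {N K B : ℕ} {d : Fin K → ℕ}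
    (h : ∀ S' : Fin K → Matrix (Fin N) (Fin N) ℝ, (∀ l, (S' l).IsSymm) →
      (∀ (ι : Type) [Fintype ι] [DecidableEq ι] (f : ι → Fin N), Function.Injective f →
        (∑ l, ((X : ℝ[X]) ^ d l) • ((S' l).submatrix f f).map Polynomial.C).det ≠ 0) →
      ((∑ l, ((X : ℝ[X]) ^ d l) • (S' l).map Polynomial.C).det.roots.toFinset.filter (fun t => 0 < t)).card ≤ B) :
    PosRootLawOn N K B d := by
  intro S hS
  by_cases hG : (∑ l, ((X : ℝ[X]) ^ d l) • (S l).map Polynomial.C).det = 0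
  · rw [hG, Polynomial.roots_zero]
    simp
  obtain ⟨S', hS', hroots, hpiv⟩ := exists_congruent_nondegenerate_pivots d S hS hG
  rw [← hroots]
  exact h S' hS' hpiv

/-- the same in all-real-roots currency (distinct real roots). [this work] -/
theorem card_roots_le_of_nondegenerate_pivots {N K B : ℕ} {d : Fin K → ℕ}
    (h : ∀ S' : Fin K → Matrix (Fin N) (Fin N) ℝ, (∀ l, (S' l).IsSymm) →
      (∀ (ι : Type) [Fintype ι] [DecidableEq ι] (f : ι → Fin N), Function.Injective f →
        (∑ l, ((X : ℝ[X]) ^ d l) • ((S' l).submatrix f f).map Polynomial.C).det ≠ 0) →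
      (∑ l, ((X : ℝ[X]) ^ d l) • (S' l).map Polynomial.C).det.roots.toFinset.card ≤ B)
    (S : Fin K → Matrix (Fin N) (Fin N) ℝ) (hS : ∀ l, (S l).IsSymm) :
    (∑ l, ((X : ℝ[X]) ^ d l) • (S l).map Polynomial.C).det.roots.toFinset.card ≤ B := by
  by_cases hG : (∑ l, ((X : ℝ[X]) ^ d l) • (S l).map Polynomial.C).det = 0
  · rw [hG, Polynomial.roots_zero]
    simp
  obtain ⟨S', hS', hroots, hpiv⟩ := exists_congruent_nondegenerate_pivots d S hS hG
  rw [← hroots]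
  exact h S' hS' hpiv

end Summit.ValiantsHypothesis.ValiantsHypothesis.Theorems.KPlusLogSqLaw.TowerGraft
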